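import Summits.ResolutionOfSingularities.ResolutionOfSingularities.Theorems.HomologicalConductorNoZenoSplitExcCount
import HarnessLib

/-!
# Crux `NoZenoR` (stmt-ResolutionOfSingularities-19943), β layer, slot 5 seam0 (BC-I):
# principality of `I·𝒪` survives base change — naturality of the structure map `toStalk`

Route `ResolutionOfSingularities/HomologicalConductor`, crux chain W4.4.  OURS (cell res-hironaka; object (BC-I) of the
seam0 «UPSTAIRS TRANSFER PACKAGE» (res-L0-w44-lead-1 SPEC 2026-08-27T21:26:18Z (U5), planner res-L0-w44-plan-1 DESK WORD
24/26), hand res-D-pv-039; consumer: the slot-5 closer glue of res-L0-w44-lead-1).  Pure scheme plumbing over Mathlib and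
U8b's `toStalk` (`…NoZenoSplitExcCount`); AI-written, weaker than expert review; nothing here is a statement of the
manuscript under review (Hironaka 2017); no Theses file is imported.  Def-free, fact-free,
`--supports 19943 --as helper`.

Setting: a commutative square of schemes over rings
`σ ≫ ψ = ψ' ≫ Spec φ` (`ψ : Y → Spec R`, `ψ' : Y' → Spec R_B`, `σ : Y' → Y`, `φ : R → R_B`), e.g. the base change
`σ¹ : X¹_f → X¹` of `ρ ≫ π : X¹ → Spec D` along the one-root germ `D → D_f`.

* **`toStalk_comp_eq_stalkMap_comp`** — NATURALITY of the structure map `toStalk f y : R → 𝒪_(Y,y)` of U8b: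
  `toStalk ψ' y' ∘ φ = σ.stalkMap y' ∘ toStalk ψ (σ y')`;
* `isLocalHom_toStalk_of_sq` — for `φ` local: if `toStalk ψ' y'` is local then so is `toStalk ψ (σ y')`;
* **`isPrincipal_map_toStalk_of_sq`** — (BC-I) = (U5) of the seam0 SPEC: if `I·𝒪_(Y,y)` is principal at every `y` with
  `toStalk ψ y` local (the `IsSepX1Sandwiched` clause `hprin`, verbatim), then `(I·R_B)·𝒪_(Y',y')` is principal at every
  `y'` with `toStalk ψ' y'` local (principal ideals extend to principal ideals along `σ.stalkMap y'`);
* `map_map_toStalk_eq` — the bookkeeping identity `(I·R_B)·𝒪_(Y',y') = (I·𝒪_(Y,σ y'))·𝒪_(Y',y')`.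

References: A. Grothendieck, EGA I (1960) §2.2 (stalks of morphisms of ringed spaces; folklore) [folklore];
J. Lipman, Publ. Math. IHÉS 36 (1969) §16 (16.1) p. 231 (context: base change of the sandwich datum) [`Lipman1969`].
-/

noncomputable section

-- single-problem summit: the doubled namespace component `ResolutionOfSingularities` is forced
set_option linter.dupNamespace false

namespace Summit.ResolutionOfSingularities.ResolutionOfSingularities.Theorems.NoZeno.ExcCount

open CategoryTheory AlgebraicGeometry

section Square

variable {R RB : Type} [CommRing R] [CommRing RB] (φ : R →+* RB)
  {Y Y' : Scheme.{0}} (ψ : Y ⟶ Spec (.of R)) (ψ' : Y' ⟶ Spec (.of RB)) (σ : Y' ⟶ Y)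
  (hsq : σ ≫ ψ = ψ' ≫ Spec.map (CommRingCat.ofHom φ))

include hsq in
/-- Global sections: `Γ(σ) ∘ Γ(ψ) ∘ (R ≅ Γ(Spec R)) = Γ(ψ') ∘ (R_B ≅ Γ(Spec R_B)) ∘ φ` for a commutative square
`σ ≫ ψ = ψ' ≫ Spec φ`. [folklore] -/
theorem ΓSpecIso_inv_comp_appTop_comp_appTop :
    (Scheme.ΓSpecIso (.of R)).inv ≫ ψ.appTop ≫ σ.appTop =
      CommRingCat.ofHom φ ≫ (Scheme.ΓSpecIso (.of RB)).inv ≫ ψ'.appTop := by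
  rw [← Scheme.Hom.comp_appTop, hsq, Scheme.Hom.comp_appTop, ← Category.assoc,
    ← Scheme.ΓSpecIso_inv_naturality, Category.assoc]

include hsq in
/-- **Naturality of the structure map `toStalk`.**  For a commutative square `σ ≫ ψ = ψ' ≫ Spec φ` and `y' ∈ Y'`:
`toStalk ψ' y' ∘ φ = 𝒪(σ)_y' ∘ toStalk ψ (σ y')` as ring maps `R → 𝒪_(Y', y')`. [folklore] -/
theorem toStalk_comp_eq_stalkMap_comp (y' : Y') :
    (toStalk ψ' y').comp φ = (σ.stalkMap y').hom.comp (toStalk ψ (σ.base y')) := by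
  ext r
  change (Y'.presheaf.germ ⊤ y' trivial).hom (ψ'.appTop.hom ((Scheme.ΓSpecIso (.of RB)).inv.hom (φ r))) =
    (σ.stalkMap y').hom ((Y.presheaf.germ ⊤ (σ.base y') trivial).hom
      (ψ.appTop.hom ((Scheme.ΓSpecIso (.of R)).inv.hom r)))
  rw [Scheme.Hom.germ_stalkMap_apply]
  have helt := congrArg (fun κ : CommRingCat.of R ⟶ _ => κ.hom r)
    (ΓSpecIso_inv_comp_appTop_comp_appTop φ ψ ψ' σ hsq)
  simp only [CommRingCat.hom_comp, RingHom.comp_apply, CommRingCat.hom_ofHom] at helt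
  rw [← helt]
  rfl

include hsq in
/-- The same, applied to an element. [folklore] -/
theorem toStalk_apply_eq_stalkMap_toStalk (y' : Y') (r : R) :
    toStalk ψ' y' (φ r) = (σ.stalkMap y').hom (toStalk ψ (σ.base y') r) :=
  RingHom.congr_fun (toStalk_comp_eq_stalkMap_comp φ ψ ψ' σ hsq y') r

include hsq in
/-- **Locality transfers downstairs.**  If `φ` is local and `toStalk ψ' y'` is local, then `toStalk ψ (σ y')` is local
(`𝒪(σ)_y' ∘ toStalk ψ (σ y') = toStalk ψ' y' ∘ φ` is local). [folklore] -/
theorem isLocalHom_toStalk_of_sq [IsLocalHom φ] (y' : Y') (h : IsLocalHom (toStalk ψ' y')) :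
    IsLocalHom (toStalk ψ (σ.base y')) := by
  refine ⟨fun a ha => ?_⟩
  have h1 : IsUnit ((σ.stalkMap y').hom (toStalk ψ (σ.base y') a)) := ha.map _
  rw [← toStalk_apply_eq_stalkMap_toStalk φ ψ ψ' σ hsq y' a] at h1
  exact IsLocalHom.map_nonunit a (IsLocalHom.map_nonunit (φ a) h1)

include hsq in
/-- Bookkeeping: `(I·R_B)·𝒪_(Y',y') = (I·𝒪_(Y, σ y'))·𝒪_(Y',y')` (extension along `𝒪(σ)_y'`). [folklore] -/
theorem map_map_toStalk_eq (I : Ideal R) (y' : Y') :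
    (I.map φ).map (toStalk ψ' y') = (I.map (toStalk ψ (σ.base y'))).map (σ.stalkMap y').hom := by
  rw [Ideal.map_map, Ideal.map_map, toStalk_comp_eq_stalkMap_comp φ ψ ψ' σ hsq y']

include hsq in
/-- **(BC-I) Principality survives base change.**  For a commutative square `σ ≫ ψ = ψ' ≫ Spec φ` with `φ : R → R_B`
local and an ideal `I ⊆ R`: if `I·𝒪_(Y,y)` is principal at every point `y` where `toStalk ψ y` is local (the
`IsSepX1Sandwiched` clause `hprin`), then `(I·R_B)·𝒪_(Y',y')` is principal at every point `y'` where `toStalk ψ' y'` is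
local.  (`toStalk ψ (σ y')` is then local, and principal ideals extend to principal ideals.) [this work] -/
theorem isPrincipal_map_toStalk_of_sq [IsLocalHom φ] (I : Ideal R)
    (hprin : ∀ y : Y, IsLocalHom (toStalk ψ y) → (I.map (toStalk ψ y)).IsPrincipal) :
    ∀ y' : Y', IsLocalHom (toStalk ψ' y') → ((I.map φ).map (toStalk ψ' y')).IsPrincipal := by
  intro y' hy'
  have hloc := isLocalHom_toStalk_of_sq φ ψ ψ' σ hsq y' hy'
  obtain ⟨a, ha⟩ := (hprin _ hloc).principal
  rw [map_map_toStalk_eq φ ψ ψ' σ hsq I y']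
  refine ⟨⟨(σ.stalkMap y').hom a, ?_⟩⟩
  change (I.map (toStalk ψ (σ.base y'))).map (σ.stalkMap y').hom = Ideal.span {(σ.stalkMap y').hom a}
  rw [show I.map (toStalk ψ (σ.base y')) = Ideal.span {a} from ha, Ideal.map_span, Set.image_singleton]

end Square

end Summit.ResolutionOfSingularities.ResolutionOfSingularities.Theorems.NoZeno.ExcCount

end
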